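import Mathlib
import HarnessLib
import Summits.AnomalousDissipation.AnomalousDissipation.Theses.MomentParity
import Literature.Analysis.FluidPDE.StatisticalSolution
import Literature.Analysis.FunctionSpaces.TorusTrigPoly

/-!
# Sketch — crux-ideate QuarticGate (stmt-AnomalousDissipation-11464), ideator 2, round 1

First lemmas of the idea cards `viscous-inversion` and `passive-third-component`, plus two
structural lemmas (`ShellBudget`, `LazyWitnessRigidity`) cited by both, stated over existing
declarations only (no proofs). Vocabulary `IsLevel` / `IsBandTest` / `polyGrad` / `IsPolyStationary`
is verbatim that of `Cruxes/QuarticGate/Disproof.lean` and `Ideate1Sketch.lean`.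
-/

namespace Summit.AnomalousDissipation.AnomalousDissipation.Cruxes.QuarticGate.Ideate2

open MeasureTheory Filter
open Literature.Analysis.FunctionSpaces Literature.Analysis.FluidPDE

/-- `u ∈ H` is carried by the level-`N` Fourier–Galerkin space (verbatim clause of `QuarticGate`). -/
def IsLevel (N : ℕ) (u : Torus.energySpace (Fin 3)) : Prop :=
  ∀ k ∉ (Torus.freqBall N).erase (0 : Fin 3 → ℤ),
    UnitAddTorus.mFourierCoeff (EuclideanSpace.complexify ∘
      (u.1 : UnitAddTorus (Fin 3) → EuclideanSpace ℝ (Fin 3))) k = 0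

/-- band-limited smooth solenoidal mean-zero test field (verbatim clause of `QuarticGate`). -/
def IsBandTest (N : ℕ) (g : UnitAddTorus (Fin 3) → EuclideanSpace ℝ (Fin 3)) : Prop :=
  Torus.IsSmooth g ∧ Torus.IsDivFree g ∧ Torus.HasZeroMean g ∧
    ∀ k ∉ (Torus.freqBall N).erase (0 : Fin 3 → ℤ),
      UnitAddTorus.mFourierCoeff (EuclideanSpace.complexify ∘ g) k = 0

/-- A level-`N` band test which is a Stokes eigenfield, `Δg = −lam·g` (every real Fourier mode
`a cos(2πk·x)`, `a sin(2πk·x)` with `a ⊥ k`, `0 < |k| ≤ N`, `lam = 4π²|k|²`; products of pairs of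
them span all quadratic forms on the level-`N` space). -/
def IsEigenTest (N : ℕ) (lam : ℝ) (g : UnitAddTorus (Fin 3) → EuclideanSpace ℝ (Fin 3)) : Prop :=
  IsBandTest N g ∧ ∀ x, Torus.laplacian g x = (-lam) • g x

/-- `∇p(u) = Σᵢ ∂ᵢP((u,g₁),…,(u,gₘ)) gᵢ` (verbatim test-field expression of `QuarticGate`). -/
noncomputable def polyGrad {m : ℕ} (g : Fin m → UnitAddTorus (Fin 3) → EuclideanSpace ℝ (Fin 3))
    (P : MvPolynomial (Fin m) ℝ) (u : Torus.energySpace (Fin 3)) :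
    UnitAddTorus (Fin 3) → EuclideanSpace ℝ (Fin 3) :=
  fun x => ∑ i : Fin m,
    (MvPolynomial.eval (fun j => Torus.pairing u.1 (g j)) (MvPolynomial.pderiv i P)) • g i x

/-- `d`-stationarity at `(ν, f)` and level `N` (verbatim, as in `Disproof.lean`). -/
def IsPolyStationary (ν : ℝ) (f : UnitAddTorus (Fin 3) → EuclideanSpace ℝ (Fin 3)) (N d : ℕ)
    (μ : Measure (Torus.energySpace (Fin 3))) : Prop :=
  ∀ (m : ℕ) (g : Fin m → UnitAddTorus (Fin 3) → EuclideanSpace ℝ (Fin 3))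
    (P : MvPolynomial (Fin m) ℝ), (∀ i, IsBandTest N (g i)) → P.totalDegree + 1 ≤ d →
    Integrable (fun u => Torus.nsGeneratorPairing ν f u (polyGrad g P u)) μ ∧
      ∫ u, Torus.nsGeneratorPairing ν f u (polyGrad g P u) ∂μ = 0

/-! ## Card `viscous-inversion` -/

/-- CARD `viscous-inversion`, first lemma (the SYLVESTER ROW IDENTITY): the row of the quadratic
observable `p(u) = (u,g₁)(u,g₂)` against two Stokes eigen-tests is an AFFINE function of the second
moment `M₂(g₁,g₂) = ∫(u,g₁)(u,g₂)dμ` with the INVERTIBLE coefficient `−ν(lam₁+lam₂)`; the constant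
term is the forcing drift `(f,g₁)ū(g₂) + (f,g₂)ū(g₁)` plus the Euler transfer
`T(g₁,g₂) = ∫ [(u,g₂)·∫(u⊗u):∇g₁ + (u,g₁)·∫(u⊗u):∇g₂] dμ`, a linear functional of the THIRD moment
only. (Pure unfolding of `nsGeneratorPairing` + `polyGrad` for `P = X₀X₁`; integrability from
`∫‖u‖³ < ∞`.) -/
def SylvesterRow : Prop :=
  ∀ (ν : ℝ) (f : UnitAddTorus (Fin 3) → EuclideanSpace ℝ (Fin 3)) (N : ℕ)
    (μ : Measure (Torus.energySpace (Fin 3))),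
    Torus.IsSmooth f → IsProbabilityMeasure μ → (∀ᵐ u ∂μ, IsLevel N u) →
    Integrable (fun u : Torus.energySpace (Fin 3) => ‖u‖ ^ 3) μ →
    ∀ (lam₁ lam₂ : ℝ) (g₁ g₂ : UnitAddTorus (Fin 3) → EuclideanSpace ℝ (Fin 3)),
      IsEigenTest N lam₁ g₁ → IsEigenTest N lam₂ g₂ →
      ∫ u, Torus.nsGeneratorPairing ν f u
          (polyGrad ![g₁, g₂] (MvPolynomial.X 0 * MvPolynomial.X 1 : MvPolynomial (Fin 2) ℝ) u) ∂μ =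
        (∫ x, @inner ℝ _ _ (f x) (g₁ x)) * (∫ u, Torus.pairing u.1 g₂ ∂μ) +
          (∫ x, @inner ℝ _ _ (f x) (g₂ x)) * (∫ u, Torus.pairing u.1 g₁ ∂μ) -
          ν * (lam₁ + lam₂) * (∫ u, Torus.pairing u.1 g₁ * Torus.pairing u.1 g₂ ∂μ) +
          ∫ u, (Torus.pairing u.1 g₂ * Torus.inertialPairing u.1 g₁ +
            Torus.pairing u.1 g₁ * Torus.inertialPairing u.1 g₂) ∂μ

/-- CARD `viscous-inversion`, the lever as a statement (VISCOUS INVERSION): if the second moment of a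
level-`N` law SOLVES the Sylvester/Lyapunov balance
`ν(lam₁+lam₂)·M₂(g₁,g₂) = (f,g₁)ū(g₂) + (f,g₂)ū(g₁) + T(g₁,g₂)` for every pair of eigen-tests —
an equation that has a (unique) solution `M₂` for EVERY prescribed mean `ū` and third moment,
because `ν > 0` and `lam ≥ 4π²` — then EVERY homogeneous quadratic row vanishes: all two-point
budgets of Galerkin NS close identically, quadratic-Casimir rows (energy, helicity, and any
accidental invariant of the truncation) included, with no classification of Casimirs.
(Proof: rows are linear in the test's quadratic form; products of eigen-tests span.) -/
def ViscousInversion : Prop :=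
  ∀ (ν : ℝ) (f : UnitAddTorus (Fin 3) → EuclideanSpace ℝ (Fin 3)) (N : ℕ)
    (μ : Measure (Torus.energySpace (Fin 3))),
    Torus.IsSmooth f → IsProbabilityMeasure μ → (∀ᵐ u ∂μ, IsLevel N u) →
    Integrable (fun u : Torus.energySpace (Fin 3) => ‖u‖ ^ 3) μ →
    (∀ (lam₁ lam₂ : ℝ) (g₁ g₂ : UnitAddTorus (Fin 3) → EuclideanSpace ℝ (Fin 3)),
      IsEigenTest N lam₁ g₁ → IsEigenTest N lam₂ g₂ →
        ν * (lam₁ + lam₂) * (∫ u, Torus.pairing u.1 g₁ * Torus.pairing u.1 g₂ ∂μ) =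
          (∫ x, @inner ℝ _ _ (f x) (g₁ x)) * (∫ u, Torus.pairing u.1 g₂ ∂μ) +
            (∫ x, @inner ℝ _ _ (f x) (g₂ x)) * (∫ u, Torus.pairing u.1 g₁ ∂μ) +
            ∫ u, (Torus.pairing u.1 g₂ * Torus.inertialPairing u.1 g₁ +
              Torus.pairing u.1 g₁ * Torus.inertialPairing u.1 g₂) ∂μ) →
    ∀ (m : ℕ) (g : Fin m → UnitAddTorus (Fin 3) → EuclideanSpace ℝ (Fin 3))
      (P : MvPolynomial (Fin m) ℝ), (∀ i, IsBandTest N (g i)) → P.IsHomogeneous 2 →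
      Integrable (fun u => Torus.nsGeneratorPairing ν f u (polyGrad g P u)) μ ∧
        ∫ u, Torus.nsGeneratorPairing ν f u (polyGrad g P u) ∂μ = 0

/-! ## Structural lemmas cited by the cards (modal budget; lazy-witness rigidity) -/

/-- Structural lemma (SHELL BUDGET): for a 3-stationary level-`N` law and an
unforced Stokes eigen-test `g` (`(f,g) = 0`), the modal energy budget reads
`ν·lam·∫(u,g)²dμ = ∫ (u,g)·∫(u⊗u):∇g dμ` — dissipation in the direction `g` equals the Euler
transfer into it: variances are OUTPUTS (income / `ν·lam`) of any transfer design — the diagonal case of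
`SylvesterRow`. (Row of `P = X₀²`.) -/
def ShellBudget : Prop :=
  ∀ (ν : ℝ) (f : UnitAddTorus (Fin 3) → EuclideanSpace ℝ (Fin 3)) (N : ℕ)
    (μ : Measure (Torus.energySpace (Fin 3))),
    Torus.IsSmooth f → IsProbabilityMeasure μ → (∀ᵐ u ∂μ, IsLevel N u) →
    Integrable (fun u : Torus.energySpace (Fin 3) => ‖u‖ ^ 3) μ → IsPolyStationary ν f N 3 μ →
    ∀ (lam : ℝ) (g : UnitAddTorus (Fin 3) → EuclideanSpace ℝ (Fin 3)), IsEigenTest N lam g →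
      (∫ x, @inner ℝ _ _ (f x) (g x)) = 0 →
      ν * lam * (∫ u, (Torus.pairing u.1 g) ^ 2 ∂μ) =
        ∫ u, Torus.pairing u.1 g * Torus.inertialPairing u.1 g ∂μ

/-- Structural lemma (LAZY-WITNESS RIGIDITY / the top octave is live; also a tightness lemma for
`Disproof.lean`): a law carried by level `M` (force of level `M` too) that is
4-stationary at a HIGHER level `N ≥ M` emits nothing into the shell `(M, N]`:
`∫(u⊗u):∇g = −(B(u,u), g) = 0` a.s. for every band test `g` of the shell. (Cubic test
`p(u) = Σ_t (u,g_t)·B_t(u)` over a shell frame: on the carrier `(u,g_t) = 0`, so `∇p = Σ_t B_t(u) g_t`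
and the row is `−Σ_t ∫ B_t(u)² dμ`.) Hence N-uniformly supported witness families cannot be built
once on a bounded stencil and reused at higher levels: at every level the top octave must carry
(arbitrarily small but) emitting amplitude — unless the carrier is an INVARIANT subsystem (card
`passive-third-component`: the plane `k₃ = 0` emits nothing), or the order-≤3 design is lazy and
only the order-4 atoms touch the top octave (card `viscous-inversion`). -/
def LazyWitnessRigidity : Prop :=
  ∀ (ν : ℝ) (f : UnitAddTorus (Fin 3) → EuclideanSpace ℝ (Fin 3)) (M N : ℕ)
    (μ : Measure (Torus.energySpace (Fin 3))), M ≤ N → Torus.IsSmooth f →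
    (∀ k ∉ (Torus.freqBall M).erase (0 : Fin 3 → ℤ),
      UnitAddTorus.mFourierCoeff (EuclideanSpace.complexify ∘ f) k = 0) →
    IsProbabilityMeasure μ → (∀ᵐ u ∂μ, IsLevel M u) →
    Integrable (fun u : Torus.energySpace (Fin 3) => ‖u‖ ^ 4) μ → IsPolyStationary ν f N 4 μ →
    ∀ g : UnitAddTorus (Fin 3) → EuclideanSpace ℝ (Fin 3), IsBandTest N g →
      (∀ k ∈ Torus.freqBall M, UnitAddTorus.mFourierCoeff (EuclideanSpace.complexify ∘ g) k = 0) →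
      ∀ᵐ u ∂μ, Torus.inertialPairing u.1 g = 0


/-! ## Card `passive-third-component` -/

/-- Planar (x₃-invariant) carrier: `û(k) = 0` whenever `k₃ ≠ 0` — the field depends on `(x₁,x₂)`
only. Together with `IsLevel N` this is the level-`N` truncation of the two-and-a-half-dimensional
subsystem (2-D Navier–Stokes for `(u₁,u₂)` + the passively transported third component `u₃`),
which is INVARIANT under Galerkin NS for an x₃-invariant force. -/
def IsPlanarCarried (u : Torus.energySpace (Fin 3)) : Prop :=
  ∀ k : Fin 3 → ℤ, k 2 ≠ 0 →
    UnitAddTorus.mFourierCoeff (EuclideanSpace.complexify ∘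
      (u.1 : UnitAddTorus (Fin 3) → EuclideanSpace ℝ (Fin 3))) k = 0

/-- x₃-invariant field (test or force), spectrally. -/
def IsPlanarField (g : UnitAddTorus (Fin 3) → EuclideanSpace ℝ (Fin 3)) : Prop :=
  ∀ k : Fin 3 → ℤ, k 2 ≠ 0 → UnitAddTorus.mFourierCoeff (EuclideanSpace.complexify ∘ g) k = 0

/-- CARD `passive-third-component`, first lemma (SUBSYSTEM ROW CLOSURE): for an x₃-invariant force
and a law carried by x₃-invariant level-`N` fields, `d`-stationarity against the x₃-INVARIANT
polynomial cylindrical tests already implies `d`-stationarity against ALL level-`N` tests: every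
pairing `(u,gᵢ)` and every generator component `⟨F(u),gᵢ⟩ = (f,gᵢ) + ν(u,Δgᵢ) + ∫(u⊗u):∇gᵢ` only
sees the `k₃ = 0` part of `gᵢ` (the subsystem is invariant: `f`, `Δu`, `B(u,u)` are x₃-invariant),
and that part is again a smooth solenoidal mean-zero band test. So the whole crux — rows, Casimirs,
far atoms — restricts to the disc truncation of {2-D NS + passive scalar}; no rigidity trap of the
`LazyWitnessRigidity` type arises because an invariant subsystem emits nothing. -/
def SubsystemRowClosure : Prop :=
  ∀ (ν : ℝ) (f : UnitAddTorus (Fin 3) → EuclideanSpace ℝ (Fin 3)) (N d : ℕ)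
    (μ : Measure (Torus.energySpace (Fin 3))),
    Torus.IsSmooth f → IsPlanarField f → IsProbabilityMeasure μ →
    (∀ᵐ u ∂μ, IsLevel N u ∧ IsPlanarCarried u) →
    Integrable (fun u : Torus.energySpace (Fin 3) => ‖u‖ ^ d) μ →
    (∀ (m : ℕ) (g : Fin m → UnitAddTorus (Fin 3) → EuclideanSpace ℝ (Fin 3))
      (P : MvPolynomial (Fin m) ℝ), (∀ i, IsBandTest N (g i) ∧ IsPlanarField (g i)) →
      P.totalDegree + 1 ≤ d →
      Integrable (fun u => Torus.nsGeneratorPairing ν f u (polyGrad g P u)) μ ∧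
        ∫ u, Torus.nsGeneratorPairing ν f u (polyGrad g P u) ∂μ = 0) →
    IsPolyStationary ν f N d μ

/-- CARD `passive-third-component`, the parity statement the design exploits (PLANAR-QUIET /
SCALAR-FREE): in the subsystem the planar velocity obeys the enstrophy certificate (the row of the
admissible quadratic test `Σ|k|²(u,e_k^{planar})²`; cf. the TRUE support item `PlanarCubicQuiet`):
for every 3-stationary planar-carried level-`N` law, `ν∫‖∇(u₁,u₂)‖² ≤ C(g,E)·√ν`, whereas the
transported component carries the only other definite quadratic budget, its own variance row
`ν∫‖∇u₃‖² dμ = ∫ (h, u₃) dμ` (`h = f₃`) — which is the loudness itself, not a ceiling. Stated here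
as the scalar variance row (row of `P = Σ_c X_c²` over a planar scalar frame; provable now). -/
def ScalarVarianceRow : Prop :=
  ∀ (ν : ℝ) (f : UnitAddTorus (Fin 3) → EuclideanSpace ℝ (Fin 3)) (N : ℕ)
    (μ : Measure (Torus.energySpace (Fin 3))),
    Torus.IsSmooth f → IsPlanarField f → IsProbabilityMeasure μ →
    (∀ᵐ u ∂μ, IsLevel N u ∧ IsPlanarCarried u) →
    Integrable (fun u : Torus.energySpace (Fin 3) => ‖u‖ ^ 3) μ → IsPolyStationary ν f N 3 μ →
    ∀ (lam : ℝ) (g : UnitAddTorus (Fin 3) → EuclideanSpace ℝ (Fin 3)), IsEigenTest N lam g →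
      IsPlanarField g → (∀ x, g x 0 = 0 ∧ g x 1 = 0) →
      ν * lam * (∫ u, (Torus.pairing u.1 g) ^ 2 ∂μ) =
        (∫ x, @inner ℝ _ _ (f x) (g x)) * (∫ u, Torus.pairing u.1 g ∂μ) +
          ∫ u, Torus.pairing u.1 g * Torus.inertialPairing u.1 g ∂μ

/-- Sanity: the crux decl is in scope under its route name. -/
example : Prop := Summit.AnomalousDissipation.AnomalousDissipation.Theses.MomentParity.QuarticGate

end Summit.AnomalousDissipation.AnomalousDissipation.Cruxes.QuarticGate.Ideate2
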